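import Summits.ABC.IUTFork.Cor312LicenceOfReach
import HarnessLib

/-!
# [IUTchIII] Cor. 3.12 — the (xi-f) LICENCE at the sharp real settings from MULTI-SLOT (Ind2)-reachability
# (ALL `j+1` tensor slots inflate: the positive half of the ramification/depth dichotomy, sharpened)

PROOF-ONLY record file (D-0012; 0 definitions, 0 `Prop` facts) of the abc-iut cell (WAVE-5 prover seat abc-iut-w5-d107, gen 6;
sequel of this seat's E3 case-A files p433872/p435430/p436396/p437756 and of abc-iut-w4-d094's `Cor312LicenceOfReach` p437055/p437564,
whose §1–§2 are the template followed here line by line). TAKES NO SIDE on [IUTchIII] Cor. 3.12 (kurims `paper:url-4b091feeb646`,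
Cor. 3.12 p. 173–174; Step (xi-f) p. 184 l. 26–27) or on any author: every statement is about OUR typed objects — abc-iut-c312-1's
`Thm311ToCor312.Licence`, abc-iut-c312-3's / abc-iut-c312-7's SHARP idele settings `Real.settingDHVolSharp` / `Real.settingPrVolSharp`,
and the typed (Ind2) of abc-iut-c312-5's `Real.logShellsDH` (`LogShells.Ind2 j v_ℚ` = factor-AND-summand-wise families
`⊗_a ⊕_v g_{a,v}`, `g_{a,v} ∈ Ism_v`, INDEPENDENT per tensor slot `a` — Dupuy–Hilado §4.9).

WHY. abc-iut-w4-d094's `licence_settingPrVolSharp_of_reach` derives the licence from ONE-FACTOR reachability (a mover on the LAST slot,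
the identity on the other slots). But the typed (Ind2) moves EVERY slot independently, and the field-factor coordinates of a pure
tensor are PRODUCTS over the slots (campaign-S `psi_purePacket_apply`, `norm_factorEmb`): at a ramified place the `j` «unit» slots
`𝒪_v` inflate under `GL_{ℤ_p}(I_v)` as well (each by the log-shell gain), so the honest sufficient condition is MULTI-SLOT:

* §1 `exists_ind2Family_allSlots` — for movers `g_{a,x} ∈ Ism_x` on EVERY slot `a` and place `x | p` (with `ℚ_p`-linear forms
  `g'_{a,x}`), a typed (Ind2)-FAMILY mapping a packet element lying over the pure tensors `(⊗_a w_{v⃗,a})_{v⃗}` to one lying over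
  `(⊗_a g'_{a,v_a}(w_{v⃗,a}))_{v⃗}` (abc-iut-c312-5 `comparison_factorwise`, Mathlib `PiTensorProduct.congr_tprod`);
* §2 **`qRegion_subset_thetaHull_settingDHVolSharp_of_multiReach`** — at the packet `(i+1, p)`: IF for every summand `v⃗` there are
  movers `g_a ∈ Ism_{v_a}` and integers `y_a ∈ 𝒪_{v_a}` with `‖t_{q,v_{i+1}}‖ ≤ Π_a ‖g_a(c_a·y_a)‖`, `c_{i+1} = t_{Θ,i+1,v_{i+1}}`, `c_a = 1`
  otherwise (MULTI-REACH), THEN `qRegion ⊆ ⁿ˒°𝒰_{i+1,p}` (pure set theory: the image of the box point `⊗_a c_a y_a` has ALL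
  field-factor coordinates of norm `Π_a ‖g_a(c_a y_a)‖ ≥` the q-radius, so every hull-set containing the possible images contains the
  q-box); `multiReach_of_reach` — w4-d094's one-factor REACH is the special case `g_a = id`, `y_a = 1` for `a ≤ i`;
* §3 **`licence_settingDHVolSharp_of_multiReach` / `licence_settingPrVolSharp_of_multiReach`** — MULTI-REACH at every packet ⇒ `Licence`.

READING (neutral, numbers not adjectives). With this seat's explicit case A (`Cor312NotLicencePrVolSharpExplicit`:
`p^{(j+1)(d+a+b)+1}·‖t_{Θ,j,x₀}‖ < ‖t_{q,x₀}‖ ⇒ ¬ Licence`, the exponent `(j+1)(d+a+b)` being exactly the total log-shell gain of the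
`j+1` slots) the truth value of the hull-level clause S_H at honestly-scaled sharp data is squeezed between MULTI-REACH (⇒ Licence)
and the lattice bound (⇒ ¬ Licence); one-factor REACH is sufficient but NOT necessary (hand example in HOME/STATUS
2026-08-26T10:00:46Z: tame `e_v ≈ j²·a_v/2`). HONEST SCOPE as in the parent files: the licence is a STRONGER-THAN-PRINT set-level form
(ADJUDICATION-SPEC §2 (G1′)); OUR containers and typed (Ind1)/(Ind2)/(Ind3) (sharp boxes); nothing about the number-level
`Cor22.Cor312AtDatum` or any author's reading. [cite: DupuyHilado2025, §3.9, §4.7, §4.9] [cite: ScholzeStix2018, §2.2 pp. 9–10]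
[cite: Mochizuki2012, IUTchIII Cor. 3.12 p.173–174, Step (xi) p.183–184] [claim: Mochizuki2012, status: disputed] for every IUT
sentence quoted. typed ≠ proved; instantiated ≠ endorsed.
-/

noncomputable section

open Set Function
open scoped Pointwise

namespace Summit.ABC.IUTFork.Thm311.Real

open Cor312 Cor312Vol Literature.IUT.LogThetaLattice Literature.IUT.LogVolume NumberField IsDedekindDomain

variable {F : Type} [Field F] [NumberField F] (X : PilotData F) {logv : PadicLogs F} (hlog : LogvAnalytic logv)
  (M : Type) [Field M] [NumberField M]
  (archPk : ∀ (j : (thetaIndex X).Label) (vQ : (thetaIndex X).VQ), Set ((logShellsDH X logv).Packet j vQ))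
  (archSub : ∀ (j : (thetaIndex X).Label) (v : (thetaIndex X).V),
    Set ((logShellsDH X logv).Packet j ((thetaIndex X).over v)))
  (Ψ : ℤ → ∀ v : (thetaIndex X).V, v ∈ (thetaIndex X).Vbad → Set ((logShellsDH X logv).StarPacket v))
  (act : ℤ → ∀ v : (thetaIndex X).V, v ∈ (thetaIndex X).Vbad →
    (logShellsDH X logv).StarPacket v → Module.End ℚ ((logShellsDH X logv).StarPacket v))
  (Mmod : ℤ → ∀ j : (thetaIndex X).LabelStar, Set ((logShellsDH X logv).GlobalPacket j.1))
  (region : ℤ → ∀ j : (thetaIndex X).LabelStar, FinDivisor M → ∀ vQ : (thetaIndex X).VQ,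
    Set ((logShellsDH X logv).Packet j.1 vQ))
  (n : ℤ) {HT : Type} {LogLink : HT → HT → Type} {IsFull : ∀ {s t : HT}, LogLink s t → Prop}
  (lat : LGPGaussianLogThetaLattice LogLink IsFull)
  {Frd : Type} {IsoF : Frd → Frd → Type} {Ob : Frd → Type} {realify : Frd → Frd} {Strip : Type}
  {IsoS : Strip → Strip → Type} {Mv : ∀ v : (thetaIndex X).V, v ∈ (thetaIndex X).Vbad → Type}
  [∀ v h, Monoid (Mv v h)]
  (sig : GlobalLGPFrobenioidSignature (thetaIndex X).lstar (thetaIndex X).V (· ∈ (thetaIndex X).Vbad)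
    Frd IsoF Ob realify Strip IsoS Mv)
  (split : SplittingMonoids Mv) {ObΔ : Type} {N : ∀ v : (thetaIndex X).V, v ∈ (thetaIndex X).Vbad → Type}
  [∀ v h, Monoid (N v h)] (qData : QPilotData ObΔ N)
  (tq : ∀ (pp : Nat.Primes) (x : (thetaIndex X).Fibre (.inr pp)), haveI : Fact (pp : ℕ).Prime := ⟨pp.2⟩; kOf X pp.1 x)
  (t : ∀ (pp : Nat.Primes) (_ : Fin X.lstar) (x : (thetaIndex X).Fibre (.inr pp)),
    haveI : Fact (pp : ℕ).Prime := ⟨pp.2⟩; kOf X pp.1 x)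
  (htq0 : ∀ pp x, tq pp x ≠ 0)
  (htq1 : ∀ (pp : Nat.Primes) (x : (thetaIndex X).Fibre (.inr pp)),
    haveI : Fact (pp : ℕ).Prime := ⟨pp.2⟩; placeOf X pp.1 x ∉ X.S → ‖tq pp x‖ = 1)

/-! ## 1. An (Ind2)-family acting on ALL tensor slots, and its effect on pure tensors -/

/-- **A multi-slot (Ind2)-family and its image of pure tensors.** Given, at every slot `a` of the capsule `S^±_{j+1}` (`j = i+1`) and every
place `x | p`, an element `g_{a,x} ∈ Ism_x` with its `ℚ_p`-linear form `g'_{a,x}` (`φ_x ∘ g_{a,x} = g'_{a,x} ∘ φ_x`), there is a typed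
(Ind2)-FAMILY `Φ` (at the label `j` over `p`: `g_{a,·}` on slot `a`; elsewhere: movers read off the slot value) mapping any packet element
lying over the pure tensors `(⊗_a w_{v⃗,a})_{v⃗}` to one lying over `(⊗_a g'_{a,v_a}(w_{v⃗,a}))_{v⃗}`. [cite: DupuyHilado2025, §4.9]
[claim: Mochizuki2012, status: disputed] -/
theorem exists_ind2Family_allSlots (pp : Nat.Primes) (i : Fin (thetaIndex X).lstar)
    (g : (thetaIndex X).Caps (Setting.labelSucc i) → ∀ x : (thetaIndex X).Fibre (.inr pp),
      (logShellsDH X logv).carrier x.1 ≃ₗ[ℚ] (logShellsDH X logv).carrier x.1)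
    (hg : ∀ a x, g a x ∈ (logShellsDH X logv).ism x.1)
    (g' : (thetaIndex X).Caps (Setting.labelSucc i) → ∀ x : (thetaIndex X).Fibre (.inr pp),
      haveI : Fact (pp : ℕ).Prime := ⟨pp.2⟩; (presAt X hlog pp).k x ≃ₗ[ℚ_[pp]] (presAt X hlog pp).k x)
    (hg' : haveI : Fact (pp : ℕ).Prime := ⟨pp.2⟩; ∀ a x z, (presAt X hlog pp).φ x (g a x z) = g' a x ((presAt X hlog pp).φ x z)) :
    haveI : Fact (pp : ℕ).Prime := ⟨pp.2⟩
    ∃ Φ ∈ (logShellsDH X logv).Ind2Family,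
      ∀ (z : (logShellsDH X logv).Packet (Setting.labelSucc i) (.inr pp))
        (w : ∀ e : (thetaIndex X).Caps (Setting.labelSucc i) → (thetaIndex X).Fibre (.inr pp),
          ∀ a, (presAt X hlog pp).kk e a),
        ((presAt X hlog pp).comparison (Setting.labelSucc i) z = fun e =>
            purePacket (pp : ℕ) ((presAt X hlog pp).kk e) (w e)) →
          (presAt X hlog pp).comparison (Setting.labelSucc i) (Φ (Setting.labelSucc i) (.inr pp) z) = fun e =>
            purePacket (pp : ℕ) ((presAt X hlog pp).kk e) (fun a => g' a (e a) (w e a)) := by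
  haveI : Fact (pp : ℕ).Prime := ⟨pp.2⟩
  classical
  -- the global movers, indexed by the slot VALUE and the place: `g_{a,x}` over `p` at the slots of `S^±_{j+1}`, identity elsewhere
  let gN : ℕ → ∀ u : (thetaIndex X).V, (logShellsDH X logv).carrier u ≃ₗ[ℚ] (logShellsDH X logv).carrier u := fun m u =>
    if h : m < ((Setting.labelSucc (T := thetaIndex X) i : (thetaIndex X).Label) : ℕ) + 1 ∧ (thetaIndex X).over u = .inr pp then
      g ⟨m, h.1⟩ ⟨u, h.2⟩ else LinearEquiv.refl ℚ _
  have hgN_mem : ∀ m u, gN m u ∈ (logShellsDH X logv).ism u := by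
    intro m u
    simp only [gN]
    split_ifs with h
    · exact hg ⟨m, h.1⟩ ⟨u, h.2⟩
    · exact (logShellsDH X logv).one_mem_ism u
  have hgN_eq : ∀ (a : (thetaIndex X).Caps (Setting.labelSucc i)) (x : (thetaIndex X).Fibre (.inr pp)), gN a x.1 = g a x := by
    rintro ⟨m, hm⟩ ⟨u, hu⟩
    show (if h : m < _ + 1 ∧ (thetaIndex X).over u = .inr pp then g ⟨m, h.1⟩ ⟨u, h.2⟩ else LinearEquiv.refl ℚ _) = g ⟨m, hm⟩ ⟨u, hu⟩
    rw [dif_pos ⟨hm, hu⟩]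
  refine ⟨fun j' vQ' => (logShellsDH X logv).factorwise j' vQ' fun a =>
      (logShellsDH X logv).summandwise vQ' fun w => gN (a : ℕ) w.1, ?_, ?_⟩
  · intro j' vQ'
    exact ⟨fun a w => gN (a : ℕ) w.1, fun a w => hgN_mem _ w.1, rfl⟩
  · intro z w hz
    have key := (presAt X hlog pp).comparison_factorwise (j := Setting.labelSucc i)
      (fun a (x : (thetaIndex X).Fibre (.inr pp)) => gN (a : ℕ) x.1) (fun a x => g' a x) (fun a x ξ => by
        show (presAt X hlog pp).φ x (gN (a : ℕ) x.1 ξ) = g' a x ((presAt X hlog pp).φ x ξ)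
        rw [hgN_eq]; exact hg' a x ξ) z
    rw [key, hz]
    funext e
    dsimp only
    rw [purePacket, purePacket, PiTensorProduct.congr_tprod]

/-! ## 2. The (xi-f) inclusion at one packet from multi-slot reachability -/

/-- **The licence inclusion `qRegion ⊆ ⁿ˒°𝒰_{i+1,p}` at the sharp DH setting from MULTI-SLOT (Ind2)-REACHABILITY.** If for every
summand `v⃗` of the packet `(i+1, p)` there are movers `g_a ∈ Ism_{v_a}` (one per slot) and `y_a ∈ K_{v_a}` with `‖y_a‖ ≤ 1` such that
`‖t_{q,v_{i+1}}‖ ≤ Π_a ‖g_a(c_a·y_a)‖` (read through `φ`), where `c_{i+1} = t_{Θ,i+1,v_{i+1}}` and `c_a = 1` for `a ≤ i`, then the q-pilot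
region lies in the holomorphic hull of the union of the possible images of the Θ-pilot region at that packet. No hypothesis on `p` or on
the ramification of `F`. [cite: DupuyHilado2025, §3.9, §4.9] [cite: Mochizuki2012, IUTchIII Rmk. 3.9.5 (i) p. 127]
[claim: Mochizuki2012, status: disputed] -/
theorem qRegion_subset_thetaHull_settingDHVolSharp_of_multiReach (pp : Nat.Primes) (i : Fin (thetaIndex X).lstar)
    (hreach : haveI : Fact (pp : ℕ).Prime := ⟨pp.2⟩
      ∀ e : (thetaIndex X).Caps (Setting.labelSucc i) → (thetaIndex X).Fibre (.inr pp),
        ∃ g : (thetaIndex X).Caps (Setting.labelSucc i) → ∀ x : (thetaIndex X).Fibre (.inr pp),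
            (logShellsDH X logv).carrier x.1 ≃ₗ[ℚ] (logShellsDH X logv).carrier x.1,
          (∀ a x, g a x ∈ (logShellsDH X logv).ism x.1) ∧
          ∃ y : ∀ a, kOf X pp.1 (e a), (∀ a, ‖y a‖ ≤ 1) ∧
            ‖tq pp (e (Fin.last _))‖ ≤ ∏ a, ‖(presAt X hlog pp).φ (e a) (g a (e a) (((presAt X hlog pp).φ (e a)).symm
              ((if a = Fin.last _ then t pp i (e a) else 1) * y a)))‖) :
    (settingDHVolSharp X hlog M archPk archSub Ψ act Mmod region n lat sig split qData tq t htq0 htq1).qRegion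
        (Setting.labelSucc i) (.inr pp) ⊆
      (settingDHVolSharp X hlog M archPk archSub Ψ act Mmod region n lat sig split qData tq t htq0 htq1).thetaHull
        (Setting.labelSucc i) (.inr pp) := by
  haveI : Fact (pp : ℕ).Prime := ⟨pp.2⟩
  haveI : Nonempty ((thetaIndex X).Caps (Setting.labelSucc i)) := ⟨0⟩
  classical
  -- choose, for every summand, the movers, their `ℚ_p`-linear forms and the integers
  choose g hg y hy hreach using hreach
  choose g' hg' using fun e a x => (presAt X hlog pp).ism_linear x (g e a x) (hg e a x)
  -- the box point `z₀` over the pure tensors `⊗_a c_{v⃗,a}·y_{v⃗,a}`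
  obtain ⟨z₀, hz₀⟩ := (presAt X hlog pp).comparison_surjective (Setting.labelSucc i)
    (fun e => purePacket (pp : ℕ) ((presAt X hlog pp).kk e) (fun a => (if a = Fin.last _ then t pp i (e a) else 1) * y e a))
  have hz₀mem : z₀ ∈ (settingDHVolSharp X hlog M archPk archSub Ψ act Mmod region n lat sig split qData tq t htq0
      htq1).thetaRegion3 (Setting.labelSucc i) (.inr pp) := by
    unfold settingDHVolSharp
    rw [thetaRegion3_thetaBoxDH]
    change z₀ ∈ (fun x => (presAt X hlog pp).factorMap (Setting.labelSucc i) x) ⁻¹'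
      (presAt X hlog pp).boxOf (sharpBoxDH X hlog t pp (Setting.labelSucc i))
    rw [(presAt X hlog pp).factorMap_preimage_boxOf, Set.mem_preimage, hz₀]
    intro e _
    unfold sharpBoxDH
    rw [labelIdele_labelSucc]
    refine ⟨purePacket (pp : ℕ) ((presAt X hlog pp).kk e) (y e),
      integerPacket_le_normalizedPacket (pp : ℕ) _ (Subring.subset_closure ⟨y e, hy e, rfl⟩), ?_⟩
    dsimp only
    rw [smul_eq_mul, iota_eq_purePacket, purePacket_mul]
    congr 1
    funext a
    rw [Pi.mul_apply]
    by_cases ha : a = Fin.last _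
    · subst ha
      rw [Pi.mulSingle_eq_same, if_pos rfl]
      rfl
    · rw [Pi.mulSingle_eq_of_ne ha, if_neg ha]
      rfl
  -- the hull: either everything, or the intersection of the hull-sets containing the possible images
  intro x hx
  have hnorm_q : ∀ (e : (thetaIndex X).Caps (Setting.labelSucc i) → (thetaIndex X).Fibre (.inr pp))
      (k : DIdx (pp : ℕ) ((presAt X hlog pp).kk e)),
      ‖(presAt X hlog pp).factorMap (Setting.labelSucc i) x ⟨e, k⟩‖ ≤ ‖tq pp (e (Fin.last _))‖ := by
    intro e k
    have hx' : (presAt X hlog pp).factorMap (Setting.labelSucc i) x ∈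
        hullSet ((presAt X hlog pp).factorField (Setting.labelSucc i))
          ((presAt X hlog pp).centreOf fun e =>
            iota (pp : ℕ) ((presAt X hlog pp).kk e) (Fin.last _) (tq pp (e (Fin.last _)))) := hx
    rw [hullSet, mem_polydisc] at hx'
    refine (hx' ⟨e, k⟩).trans_eq ?_
    show ‖dEquiv (pp : ℕ) ((presAt X hlog pp).kk e) (iota (pp : ℕ) ((presAt X hlog pp).kk e) (Fin.last _)
      (tq pp (e (Fin.last _)))) k‖ = _
    rw [norm_dEquiv_iota]
    rfl
  show x ∈ ((HullFrame.ofLocalFields (factorFieldDH X hlog (Setting.labelSucc i) (.inr pp))).comap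
    (factorMapDH X hlog (Setting.labelSucc i) (.inr pp))).hull _
  unfold HullFrame.hull
  split_ifs with hb
  · rintro H ⟨⟨H', hH', rfl⟩, hUH⟩
    obtain ⟨lam, hlam0, rfl⟩ := (HullFrame.mem_ofLocalFields_hul _).1 hH'
    change (presAt X hlog pp).factorMap (Setting.labelSucc i) x ∈
      hullSet ((presAt X hlog pp).factorField (Setting.labelSucc i)) lam
    rw [hullSet, mem_polydisc]
    rintro ⟨e, k⟩
    -- the (Ind2)-family of THIS summand's movers and the image of `z₀`
    obtain ⟨Φ, hΦ, hΦz⟩ := exists_ind2Family_allSlots X hlog pp i (g e) (hg e) (g' e) (hg' e)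
    have hΦz₀ := hΦz z₀ (fun e' a => (if a = Fin.last _ then t pp i (e' a) else 1) * y e' a) hz₀
    have himage : Φ (Setting.labelSucc i) (.inr pp) z₀ ∈
        ⋃₀ (settingDHVolSharp X hlog M archPk archSub Ψ act Mmod region n lat sig split qData tq t htq0 htq1).possibleImages
          (Setting.labelSucc i) (.inr pp) :=
      Set.mem_sUnion.2 ⟨_, ⟨Φ, Subgroup.subset_closure (Set.mem_union_right _ hΦ), rfl⟩, Set.mem_image_of_mem _ hz₀mem⟩
    have hnorm_image : ‖tq pp (e (Fin.last _))‖ ≤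
        ‖(presAt X hlog pp).factorMap (Setting.labelSucc i) (Φ (Setting.labelSucc i) (.inr pp) z₀) ⟨e, k⟩‖ := by
      rw [(presAt X hlog pp).factorMap_mk, hΦz₀]
      dsimp only
      rw [psi_purePacket_apply, norm_prod]
      refine (hreach e).trans_eq (Finset.prod_congr rfl fun a _ => ?_)
      rw [norm_factorEmb, hg', LinearEquiv.apply_symm_apply]
    have hmem : (presAt X hlog pp).factorMap (Setting.labelSucc i) (Φ (Setting.labelSucc i) (.inr pp) z₀) ∈
        hullSet ((presAt X hlog pp).factorField (Setting.labelSucc i)) lam := hUH himage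
    rw [hullSet, mem_polydisc] at hmem
    exact ((hnorm_q e k).trans hnorm_image).trans (hmem ⟨e, k⟩)
  · exact Set.mem_univ x

/-- **One-factor REACH ⇒ MULTI-REACH** (`g_a = id`, `y_a = 1` on the slots `a ≤ i`): abc-iut-w4-d094's hypothesis is the special case.
[folklore] -/
theorem multiReach_of_reach (pp : Nat.Primes) (i : Fin (thetaIndex X).lstar)
    (hreach : haveI : Fact (pp : ℕ).Prime := ⟨pp.2⟩
      ∀ x : (thetaIndex X).Fibre (.inr pp), ∃ g ∈ (logShellsDH X logv).ism x.1, ∃ y : kOf X pp.1 x, ‖y‖ ≤ 1 ∧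
        ‖tq pp x‖ ≤ ‖(presAt X hlog pp).φ x (g (((presAt X hlog pp).φ x).symm (t pp i x * y)))‖)
    (e : (thetaIndex X).Caps (Setting.labelSucc i) → (thetaIndex X).Fibre (.inr pp)) :
    haveI : Fact (pp : ℕ).Prime := ⟨pp.2⟩
    ∃ g : (thetaIndex X).Caps (Setting.labelSucc i) → ∀ x : (thetaIndex X).Fibre (.inr pp),
        (logShellsDH X logv).carrier x.1 ≃ₗ[ℚ] (logShellsDH X logv).carrier x.1,
      (∀ a x, g a x ∈ (logShellsDH X logv).ism x.1) ∧
      ∃ y : ∀ a, kOf X pp.1 (e a), (∀ a, ‖y a‖ ≤ 1) ∧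
        ‖tq pp (e (Fin.last _))‖ ≤ ∏ a, ‖(presAt X hlog pp).φ (e a) (g a (e a) (((presAt X hlog pp).φ (e a)).symm
          ((if a = Fin.last _ then t pp i (e a) else 1) * y a)))‖ := by
  haveI : Fact (pp : ℕ).Prime := ⟨pp.2⟩
  classical
  choose g hg y hy hreach using hreach
  refine ⟨fun a x => if a = Fin.last _ then g x else LinearEquiv.refl ℚ _, fun a x => ?_,
    fun a => if a = Fin.last _ then y (e a) else 1, fun a => ?_, ?_⟩
  · dsimp only; split_ifs; exacts [hg x, (logShellsDH X logv).one_mem_ism x.1]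
  · dsimp only; split_ifs; exacts [hy (e a), norm_one.le]
  · rw [← Finset.mul_prod_erase Finset.univ _ (Finset.mem_univ (Fin.last _))]
    have hrest : ∏ a ∈ Finset.univ.erase (Fin.last _),
        ‖(presAt X hlog pp).φ (e a) ((if a = Fin.last _ then g (e a) else LinearEquiv.refl ℚ _)
          (((presAt X hlog pp).φ (e a)).symm ((if a = Fin.last _ then t pp i (e a) else 1) *
            (if a = Fin.last _ then y (e a) else 1))))‖ = 1 := by
      refine Finset.prod_eq_one fun a ha => ?_
      have ha' : a ≠ Fin.last _ := Finset.ne_of_mem_erase ha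
      rw [if_neg ha', if_neg ha', if_neg ha', one_mul, LinearEquiv.refl_apply, LinearEquiv.apply_symm_apply]
      exact (norm_one (α := kOf X pp.1 (e a)))
    rw [hrest, mul_one]
    dsimp only
    rw [if_pos rfl, if_pos rfl, if_pos rfl]
    exact hreach (e (Fin.last _))

/-! ## 3. The licence from multi-slot reachability -/

/-- **The (xi-f) LICENCE HOLDS at the sharp DH setting `settingDHVolSharp` as soon as MULTI-REACH holds at every packet `(i+1, p)`**
(at the archimedean packets both pilot regions are the whole packet). [cite: DupuyHilado2025, §3.9, §4.9]
[claim: Mochizuki2012, status: disputed] -/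
theorem licence_settingDHVolSharp_of_multiReach
    (hreach : ∀ (pp : Nat.Primes) (i : Fin (thetaIndex X).lstar), haveI : Fact (pp : ℕ).Prime := ⟨pp.2⟩
      ∀ e : (thetaIndex X).Caps (Setting.labelSucc i) → (thetaIndex X).Fibre (.inr pp),
        ∃ g : (thetaIndex X).Caps (Setting.labelSucc i) → ∀ x : (thetaIndex X).Fibre (.inr pp),
            (logShellsDH X logv).carrier x.1 ≃ₗ[ℚ] (logShellsDH X logv).carrier x.1,
          (∀ a x, g a x ∈ (logShellsDH X logv).ism x.1) ∧
          ∃ y : ∀ a, kOf X pp.1 (e a), (∀ a, ‖y a‖ ≤ 1) ∧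
            ‖tq pp (e (Fin.last _))‖ ≤ ∏ a, ‖(presAt X hlog pp).φ (e a) (g a (e a) (((presAt X hlog pp).φ (e a)).symm
              ((if a = Fin.last _ then t pp i (e a) else 1) * y a)))‖) :
    Thm311ToCor312.Licence
        (settingDHVolSharp X hlog M archPk archSub Ψ act Mmod region n lat sig split qData tq t htq0 htq1) := by
  intro i vQ
  cases vQ with
  | inl u =>
    -- archimedean packet: the Θ-region is everything and is a possible image (abc-iut-w4-d094's argument verbatim)
    refine subset_trans ?_ ((Set.subset_sUnion_of_mem ((settingDHVolSharp X hlog M archPk archSub Ψ act Mmod region n lat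
      sig split qData tq t htq0 htq1).thetaRegion3_mem_possibleImages (Setting.labelSucc i) (.inl u))).trans
      (((settingDHVolSharp X hlog M archPk archSub Ψ act Mmod region n lat sig split qData tq t htq0 htq1).frame
        (Setting.labelSucc i) (.inl u)).subset_hull _))
    unfold settingDHVolSharp
    rw [thetaRegion3_thetaBoxDH]
    intro x _
    exact Set.mem_univ _
  | inr pp =>
    exact qRegion_subset_thetaHull_settingDHVolSharp_of_multiReach X hlog M archPk archSub Ψ act Mmod region n lat sig split qData
      tq t htq0 htq1 pp i (hreach pp i)

/-- **… and at the PRINT-NORMALISED sharp setting `settingPrVolSharp`** (branch C's v3/v4 setting; same regions and frames, only the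
volume weights differ). [cite: DupuyHilado2025, §3.9, §4.9] [claim: Mochizuki2012, status: disputed] -/
theorem licence_settingPrVolSharp_of_multiReach
    (hreach : ∀ (pp : Nat.Primes) (i : Fin (thetaIndex X).lstar), haveI : Fact (pp : ℕ).Prime := ⟨pp.2⟩
      ∀ e : (thetaIndex X).Caps (Setting.labelSucc i) → (thetaIndex X).Fibre (.inr pp),
        ∃ g : (thetaIndex X).Caps (Setting.labelSucc i) → ∀ x : (thetaIndex X).Fibre (.inr pp),
            (logShellsDH X logv).carrier x.1 ≃ₗ[ℚ] (logShellsDH X logv).carrier x.1,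
          (∀ a x, g a x ∈ (logShellsDH X logv).ism x.1) ∧
          ∃ y : ∀ a, kOf X pp.1 (e a), (∀ a, ‖y a‖ ≤ 1) ∧
            ‖tq pp (e (Fin.last _))‖ ≤ ∏ a, ‖(presAt X hlog pp).φ (e a) (g a (e a) (((presAt X hlog pp).φ (e a)).symm
              ((if a = Fin.last _ then t pp i (e a) else 1) * y a)))‖) :
    Thm311ToCor312.Licence
        (settingPrVolSharp X hlog M archPk archSub Ψ act Mmod region n lat sig split qData tq t htq0 htq1) :=
  fun i vQ => licence_settingDHVolSharp_of_multiReach X hlog M archPk archSub Ψ act Mmod region n lat sig split qData tq t htq0 htq1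
    hreach i vQ

end Summit.ABC.IUTFork.Thm311.Real

end
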